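import Mathlib
import Summits.ValiantsHypothesis.ValiantsHypothesis.Theorems.KPlusLogSqLawWeakLiftingTowerGraftSteepZone

/-!
# Tower graft line — the CO-EULER ZONE LAW: where the rescaled base `(D − θ)G = Σ_l (D − d_l) X^{d_l} S_l` is definite, a graft
# `G + X^D·S` of ANY far letter `S` (any rank, any signature) has at most `m` roots per interval — the matrix form of the Descartes step
# that removes the TOP term

Structure file for LINE (B) `Cruxes/WeakLifting/Lines/tower_graft.lean` (crux `WeakLifting` = stmt-ValiantsHypothesis-19561), memo `tower_graft-S5.md`
§1/§3 (events, T1/T2), rungs S4/S5; sequel of `…TowerGraftSteepZone` (interval Loewner law `SteepZone.card_le_of_eulerDeriv_posDef`).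

THE SCALAR PICTURE.  For `f = g(u) + c·u^D` (`g` a K-nomial with exponents `d_l ≤ D`) one Descartes step removes the top term:
`(u^{−D} f)' = −u^{−D−1}·(D − θ)g` with `(D − θ)g = Σ_l (D − d_l) c_l u^{d_l}` — a K-nomial with the SAME SIGN PATTERN as `g`; by Rolle, between two
roots of `f` lies a root of `(D − θ)g`, whatever `c` is.  THE MATRIX FORM (this file): for `H(u) = G(u) + u^D·S`, `G = Σ_l u^{d_l} S_l` symmetric
`m × m`, `S` ANY symmetric matrix, the weight `u^{−D}` kills the far letter: `(u^{−D}H)' = −u^{−D−1}·(D − θ)G(u)`, so on every interval on which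
the CO-EULER BASE `(D − θ)G(u) = Σ_l (D − d_l) u^{d_l} S_l` is positive (or negative) DEFINITE, `u ↦ u^{−D}H(u)` is strictly Loewner monotone and
`det H` has at most `m` zeros there (one per eigenvalue branch) — `CoEulerZone.card_roots_Ioc_graft_le_of_posDef` / `_of_negDef`.  Proof: the
substitution `u = 1/s` turns `u^{−D}H(u)` into the POLYNOMIAL family `W(s) = Σ_l s^{D − d_l} S_l + s^0·S` whose Euler derivative
`Σ_l (D − d_l) s^{D−d_l} S_l = s^D·(D − θ)G(1/s)` does not see `S`; then `SteepZone.card_le_of_eulerDeriv_posDef` on `[1/b, 1/a]`.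
READING FOR THE LINE (honest).  (i) On a tower top (`m·d_l < D`) the co-Euler base is the letter-wise rescaling `D·Σ_l (1 − d_l/D) u^{d_l} S_l` of
`G` by factors in `(1 − 1/m, 1]` — a CLASS MEMBER on the same support with the same letter signs; so the roots of ANY one-letter graft lying in the
definite zone of this class member cost `≤ m` per component, and the number of components is governed by the real zeros of ITS determinant (a class
count).  (ii) What is NOT controlled is the graft's root count inside the INDEFINITE ZONE of the co-Euler base — for `m = 1` that zone is a finite
set and the scalar Descartes induction closes; for `m ≥ 2` it has interior, and that is exactly where the T2/T3 content of S5 (near-axis class law,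
folds) lives.  (iii) Contrast with `…SteepZone` (weight `1`, needs the far letter DEFINITE and dominant) and `…OperatorRoucheLetterZone` (root-free
letter zone): here the far letter is arbitrary and invisible to the test.  Zero stub credit; S4/S4b/S5, TowerB, `WeakLifting`, Conjecture B, 18050,
VP ≠ VNP untouched.  Def-free; Mathlib + `…TowerGraftSteepZone`.  Seat: prover val-sym-lift-p2 g23, `--supports stmt-ValiantsHypothesis-19561 --as helper`.
[folklore: the Descartes/Rolle step and Loewner monotonicity; the matrix packaging for the line is this work]
-/

-- `Summit.ValiantsHypothesis.ValiantsHypothesis.…` repeats a component by the D-0017 layout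
-- (single-conjunct summit), which the `dupNamespace` linter flags; the name is mandated.
set_option linter.dupNamespace false
set_option autoImplicit false

namespace Summit.ValiantsHypothesis.ValiantsHypothesis.Theorems.KPlusLogSqLaw.TowerGraft

open Matrix Finset Polynomial
open scoped BigOperators

namespace CoEulerZone

variable {m K : ℕ}

/-! ## §1 The reversed family `W(s) = Σ_l s^{D − d_l} S_l + S` and its relation to `H(u) = G(u) + u^D S` at `u = 1/s` -/

/-- `u^D · (1/u)^{D − d} = u^d` for `d ≤ D`, `u ≠ 0`. [folklore] -/
theorem pow_mul_inv_pow_sub {u : ℝ} (hu : u ≠ 0) {d D : ℕ} (hdD : d ≤ D) : u ^ D * u⁻¹ ^ (D - d) = u ^ d := by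
  have h : u ^ D = u ^ d * u ^ (D - d) := by rw [← pow_add, Nat.add_sub_cancel' hdD]
  rw [inv_pow, h, mul_assoc, mul_inv_cancel₀ (pow_ne_zero _ hu), mul_one]

/-- the graft family at `u` is `u^D` times the reversed family at `1/u`:
`Σ_l u^{d_l} S_l + u^D S = u^D • (Σ_l (1/u)^{D − d_l} S_l + S)` (`d_l ≤ D`, `u ≠ 0`). [folklore] -/
theorem graft_eq_smul_reversed (D : ℕ) (d : Fin K → ℕ) (hdD : ∀ l, d l ≤ D) (S : Fin K → Matrix (Fin m) (Fin m) ℝ)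
    (Sfar : Matrix (Fin m) (Fin m) ℝ) {u : ℝ} (hu : u ≠ 0) :
    (∑ l, (u ^ d l) • S l) + (u ^ D) • Sfar = (u ^ D) • ((∑ l, (u⁻¹ ^ (D - d l)) • S l) + Sfar) := by
  rw [smul_add, Finset.smul_sum]
  congr 1
  refine Finset.sum_congr rfl fun l _ => ?_
  rw [smul_smul, pow_mul_inv_pow_sub hu (hdD l)]

/-- the reversed family written as ONE exponent family on `Fin (K + 1)` (exponents `snoc (D − d) 0`, letters `snoc S Sfar`). [folklore] -/
theorem reversed_eq_family (D : ℕ) (d : Fin K → ℕ) (S : Fin K → Matrix (Fin m) (Fin m) ℝ) (Sfar : Matrix (Fin m) (Fin m) ℝ) (s : ℝ) :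
    (∑ l, (s ^ (D - d l)) • S l) + Sfar =
      ∑ l : Fin (K + 1), (s ^ (Fin.snoc (fun l => D - d l) 0 : Fin (K + 1) → ℕ) l) • (Fin.snoc S Sfar : Fin (K + 1) → _) l := by
  rw [Fin.sum_univ_castSucc]
  simp only [Fin.snoc_castSucc, Fin.snoc_last, pow_zero, one_smul]

/-- the Euler derivative of the reversed family at `s = 1/u` is `s^D` times the CO-EULER BASE `Σ_l (D − d_l) u^{d_l} S_l` — the far letter is
invisible (exponent `0`). [this work] -/
theorem eulerDeriv_reversed_eq (D : ℕ) (d : Fin K → ℕ) (hdD : ∀ l, d l ≤ D) (S : Fin K → Matrix (Fin m) (Fin m) ℝ)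
    (Sfar : Matrix (Fin m) (Fin m) ℝ) {u : ℝ} (hu : u ≠ 0) :
    (∑ l : Fin (K + 1), (((Fin.snoc (fun l => D - d l) 0 : Fin (K + 1) → ℕ) l : ℝ) *
        u⁻¹ ^ (Fin.snoc (fun l => D - d l) 0 : Fin (K + 1) → ℕ) l) • (Fin.snoc S Sfar : Fin (K + 1) → _) l) =
      (u⁻¹ ^ D) • ∑ l, (((D - d l : ℕ) : ℝ) * u ^ d l) • S l := by
  rw [Fin.sum_univ_castSucc]
  simp only [Fin.snoc_castSucc, Fin.snoc_last, Nat.cast_zero, zero_mul, zero_smul, add_zero, Finset.smul_sum, smul_smul]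
  refine Finset.sum_congr rfl fun l _ => ?_
  congr 1
  have h2 : u⁻¹ ^ D * u ^ d l = u⁻¹ ^ (D - d l) := by
    have hsplit : u⁻¹ ^ D = u⁻¹ ^ (D - d l) * u⁻¹ ^ d l := by rw [← pow_add, Nat.sub_add_cancel (hdD l)]
    rw [hsplit, mul_assoc, ← mul_pow, inv_mul_cancel₀ hu, one_pow, mul_one]
  rw [← h2]; ring

/-! ## §2 The co-Euler zone law -/

/-- the determinant of the graft pencil `G + X^D·S` evaluated at `u ≠ 0` vanishes iff the reversed family is singular at `1/u`. [folklore] -/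
theorem eval_det_graft_eq_zero_iff (D : ℕ) (d : Fin K → ℕ) (hdD : ∀ l, d l ≤ D) (S : Fin K → Matrix (Fin m) (Fin m) ℝ)
    (Sfar : Matrix (Fin m) (Fin m) ℝ) {u : ℝ} (hu : u ≠ 0) :
    (Matrix.det ((∑ l, ((X : ℝ[X]) ^ d l) • (S l).map C) + ((X : ℝ[X]) ^ D) • Sfar.map C)).eval u = 0 ↔
      Matrix.det ((∑ l, (u⁻¹ ^ (D - d l)) • S l) + Sfar) = 0 := by
  have hev : (Matrix.det ((∑ l, ((X : ℝ[X]) ^ d l) • (S l).map C) + ((X : ℝ[X]) ^ D) • Sfar.map C)).eval u =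
      Matrix.det ((∑ l, (u ^ d l) • S l) + (u ^ D) • Sfar) := by
    rw [SteepZone.eval_det_graft, Fin.sum_univ_castSucc]
    simp only [Fin.snoc_castSucc, Fin.snoc_last]
  rw [hev, graft_eq_smul_reversed D d hdD S Sfar hu, Matrix.det_smul, mul_eq_zero,
    or_iff_right (pow_ne_zero _ (pow_ne_zero _ hu))]

/-- **THE CO-EULER ZONE LAW (positive definite zone).**  `G = Σ_l X^{d_l} S_l` with symmetric `m × m` letters, `d_l ≤ D`, `S` ANY symmetric far
letter, `0 < a ≤ b`.  If the co-Euler base `Σ_l (D − d_l) u^{d_l} S_l` is positive definite for every `u ∈ [a, b]`, then `det (G + X^D·S)` has at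
most `m` roots in `(a, b]`.  (Weight `u^{−D}`: `u ↦ u^{−D}(G(u) + u^D S)` is strictly Loewner decreasing there.) [this work] -/
theorem card_roots_Ioc_graft_le_of_posDef (D : ℕ) (d : Fin K → ℕ) (hdD : ∀ l, d l ≤ D) (S : Fin K → Matrix (Fin m) (Fin m) ℝ)
    (hS : ∀ l, (S l).IsSymm) (Sfar : Matrix (Fin m) (Fin m) ℝ) (hSfar : Sfar.IsSymm) {a b : ℝ} (ha : 0 < a) (hab : a ≤ b)
    (hdef : ∀ u, a ≤ u → u ≤ b → (∑ l, (((D - d l : ℕ) : ℝ) * u ^ d l) • S l).PosDef) :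
    ((Matrix.det ((∑ l, ((X : ℝ[X]) ^ d l) • (S l).map C) + ((X : ℝ[X]) ^ D) • Sfar.map C)).roots.toFinset.filter
      (fun t => a < t ∧ t ≤ b)).card ≤ m := by
  classical
  set f := Matrix.det ((∑ l, ((X : ℝ[X]) ^ d l) • (S l).map C) + ((X : ℝ[X]) ^ D) • Sfar.map C) with hf
  set T := f.roots.toFinset.filter (fun t => a < t ∧ t ≤ b) with hT
  have hb : 0 < b := ha.trans_le hab
  -- exponents and letters of the reversed family
  let e : Fin (K + 1) → ℕ := Fin.snoc (fun l => D - d l) 0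
  let Tm : Fin (K + 1) → Matrix (Fin m) (Fin m) ℝ := Fin.snoc S Sfar
  have hTm : ∀ l, (Tm l).IsSymm := by
    intro l
    induction l using Fin.lastCases with
    | last => simpa [Tm] using hSfar
    | cast l => simpa [Tm] using hS l
  -- its Euler derivative is positive definite on `[1/b, 1/a]`
  have hθ : ∀ s, b⁻¹ ≤ s → s ≤ a⁻¹ → (∑ l, ((e l : ℝ) * s ^ e l) • Tm l).PosDef := by
    intro s hs1 hs2
    have hs0 : 0 < s := (inv_pos.mpr hb).trans_le hs1
    have hu0 : s⁻¹ ≠ 0 := inv_ne_zero hs0.ne'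
    have hu1 : a ≤ s⁻¹ := by rw [le_inv_comm₀ ha hs0]; exact hs2
    have hu2 : s⁻¹ ≤ b := by rw [inv_le_comm₀ hs0 hb]; exact hs1
    have key := eulerDeriv_reversed_eq D d hdD S Sfar hu0
    rw [inv_inv] at key
    show (∑ l : Fin (K + 1), ((e l : ℝ) * s ^ e l) • Tm l).PosDef
    rw [key]
    have hP := hdef s⁻¹ hu1 hu2
    have hH : ((s ^ D) • ∑ l, (((D - d l : ℕ) : ℝ) * s⁻¹ ^ d l) • S l).IsHermitian := by
      unfold Matrix.IsHermitian
      rw [Matrix.conjTranspose_smul, star_trivial, hP.isHermitian.eq]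
    refine Matrix.PosDef.of_dotProduct_mulVec_pos hH fun x hx => ?_
    rw [star_trivial, Matrix.smul_mulVec, dotProduct_smul, smul_eq_mul]
    have h1 := hP.dotProduct_mulVec_pos hx
    rw [star_trivial] at h1
    exact mul_pos (pow_pos hs0 _) h1
  -- the reversed root set
  set T' : Finset ℝ := T.image fun t => t⁻¹ with hT'
  have hcard : T'.card = T.card := Finset.card_image_of_injective _ inv_injective
  have hmem : ∀ t ∈ T, a < t ∧ t ≤ b ∧ f.eval t = 0 := by
    intro t ht
    rw [hT, Finset.mem_filter, Multiset.mem_toFinset] at ht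
    exact ⟨ht.2.1, ht.2.2, (Polynomial.mem_roots'.mp ht.1).2⟩
  have hmain := SteepZone.card_le_of_eulerDeriv_posDef e Tm hTm (inv_pos.mpr hb) hθ T' fun s hs => by
    rw [hT', Finset.mem_image] at hs
    obtain ⟨t, ht, rfl⟩ := hs
    obtain ⟨hat, htb, hft⟩ := hmem t ht
    have ht0 : 0 < t := ha.trans hat
    refine ⟨(inv_le_inv₀ hb ht0).mpr htb, (inv_lt_inv₀ ht0 ha).mpr hat, ?_⟩
    rw [← reversed_eq_family]
    exact (eval_det_graft_eq_zero_iff D d hdD S Sfar ht0.ne').mp hft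
  simpa [hcard] using hmain

/-- **THE CO-EULER ZONE LAW (negative definite zone)**: the same bound where `Σ_l (D − d_l) u^{d_l} S_l` is NEGATIVE definite on `[a, b]`
(negate every letter: the determinant changes by `(−1)^m`, the roots do not). [this work] -/
theorem card_roots_Ioc_graft_le_of_negDef (D : ℕ) (d : Fin K → ℕ) (hdD : ∀ l, d l ≤ D) (S : Fin K → Matrix (Fin m) (Fin m) ℝ)
    (hS : ∀ l, (S l).IsSymm) (Sfar : Matrix (Fin m) (Fin m) ℝ) (hSfar : Sfar.IsSymm) {a b : ℝ} (ha : 0 < a) (hab : a ≤ b)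
    (hdef : ∀ u, a ≤ u → u ≤ b → (-∑ l, (((D - d l : ℕ) : ℝ) * u ^ d l) • S l).PosDef) :
    ((Matrix.det ((∑ l, ((X : ℝ[X]) ^ d l) • (S l).map C) + ((X : ℝ[X]) ^ D) • Sfar.map C)).roots.toFinset.filter
      (fun t => a < t ∧ t ≤ b)).card ≤ m := by
  classical
  have hneg := card_roots_Ioc_graft_le_of_posDef D d hdD (fun l => -S l) (fun l => (hS l).neg) (-Sfar) hSfar.neg ha hab
    (fun u hu hub => by simpa [Finset.sum_neg_distrib, smul_neg] using hdef u hu hub)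
  -- the negated pencil is `−(G + X^D S)`, whose determinant has the same roots
  have hmat : (∑ l, ((X : ℝ[X]) ^ d l) • (-S l).map C) + ((X : ℝ[X]) ^ D) • (-Sfar).map C =
      -((∑ l, ((X : ℝ[X]) ^ d l) • (S l).map C) + ((X : ℝ[X]) ^ D) • Sfar.map C) := by
    ext i j
    simp only [Matrix.add_apply, Matrix.sum_apply, Matrix.smul_apply, Matrix.map_apply, Matrix.neg_apply, map_neg, smul_eq_mul,
      mul_neg, Finset.sum_neg_distrib, neg_add]
  have hC : ((-1 : ℝ[X]) ^ Fintype.card (Fin m)) = C ((-1 : ℝ) ^ Fintype.card (Fin m)) := by simp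
  rw [hmat, Matrix.det_neg, hC, Polynomial.roots_C_mul _ (pow_ne_zero _ (neg_ne_zero.mpr one_ne_zero))] at hneg
  exact hneg

end CoEulerZone

end Summit.ValiantsHypothesis.ValiantsHypothesis.Theorems.KPlusLogSqLaw.TowerGraft
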